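import Summits.ResolutionOfSingularities.ResolutionOfSingularities.Theorems.FrameStep2
import Summits.ResolutionOfSingularities.ResolutionOfSingularities.Theorems.ShallowPort1

/-!
# KCert — transporting a point blow-up certificate to the `K`-saturated local rings (Layer C6 of the tower dictionary)

0-weight TOOL toward `TightDefectClasses.TowerDictionary` (decomp-res lens-5, g39; plan `NEXT-g40.md` §6, item C6).
Pure subring algebra inside one field `L`, in the currency of `ShallowPort.PointBlowupCert` (the certificate `frame_step` consumes) and of
`FrameStep.unitSet` (units read in `L`).

THE TRANSPORT.  Let `B ⊆ B̃ ⊆ B̃'` and `B ⊆ B' ⊆ B̃'` be subrings of `L` (in the dictionary: the `k`-side stages `B = B_i`, `B' = B_{i+1}` of `StalkThread`, and their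
`K`-saturations `B̃ = B̃_i`, `B̃' = B̃_{i+1}` of `KCarrier`), let `cert : PointBlowupCert B B' M` (= `StalkThread.inextCert`), and suppose every element of `B̃'` is a
quotient `x / x'` of elements of the ring generated by `B̃ ∪ B'` with `x'` a unit of `B̃'` (`hgen`; for the carriers: `w = μ Y / μ Z` with `μ(B_{i+1} ⊗ K) ⊆ ⟨B̃_i ∪ B_{i+1}⟩`).
Then the SAME generators and chart index certify `B̃ ⊆ B̃'` as a point blow-up along `M B̃` (`transport`; values of the generators unchanged: `transport_coe_c`,
`transport_j`).  `exists_cert_of_eq` moves a certificate along an EQUALITY of base subrings (`frame_step` returns `frameRing θ' = B̃'` as an equation).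
All PROVED, 0 sorry.  [cite: NovacoskiSpivakovsky2014, Def. 2.11] (local blowing up in a chart); [cite: CossartPiltant2019, §2.2].
-/

noncomputable section

set_option linter.dupNamespace false

namespace Summit.ResolutionOfSingularities.ResolutionOfSingularities.Theorems.KCert

open Summit.ResolutionOfSingularities.ResolutionOfSingularities.Theorems.ShallowPort
open Summit.ResolutionOfSingularities.ResolutionOfSingularities.Theorems.FrameStep

variable {L : Type} [Field L]

/-! ## §1 The chart ring is monotone in the base -/

/-- The generators moved to a larger base subring.  DEFINITION (support, data). -/
def liftGen {B Bt : Subring L} (h : B ≤ Bt) {r : ℕ} (c : Fin r → B) : Fin r → Bt := fun l => ⟨c l, h (c l).2⟩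

/-- `liftGen` keeps the underlying elements of `L` (definitional). -/
@[simp] theorem coe_liftGen {B Bt : Subring L} (h : B ≤ Bt) {r : ℕ} (c : Fin r → B) (l : Fin r) : (liftGen h c l : L) = c l := rfl

/-- A ratio `c_l / c_j` lies in the chart ring. -/
theorem ratio_mem_chartClosure (B : Subring L) {r : ℕ} (c : Fin r → B) (j l : Fin r) : (c l : L) / (c j : L) ∈ chartClosure B c j :=
  Subring.subset_closure (Or.inr ⟨c l, ⟨l, rfl⟩, rfl⟩)

/-- The base lies in the chart ring. -/
theorem le_chartClosure (B : Subring L) {r : ℕ} (c : Fin r → B) (j : Fin r) : B ≤ chartClosure B c j :=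
  fun _ hx => Subring.subset_closure (Or.inl hx)

/-- **Monotonicity** `B[M/c_j] ⊆ B̃[M/c_j]` for `B ⊆ B̃`. -/
theorem chartClosure_mono {B Bt : Subring L} (h : B ≤ Bt) {r : ℕ} (c : Fin r → B) (j : Fin r) :
    chartClosure B c j ≤ chartClosure Bt (liftGen h c) j := by
  refine Subring.closure_le.mpr ?_
  rintro x (hx | ⟨y, ⟨l, rfl⟩, rfl⟩)
  · exact le_chartClosure Bt (liftGen h c) j (h hx)
  · exact ratio_mem_chartClosure Bt (liftGen h c) j l

/-! ## §2 The transport -/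

section Transport

variable {B Bt B' Bt' : Subring L} (hB : B ≤ Bt) (hBt : Bt ≤ Bt') (hB' : B' ≤ Bt') {M : Ideal B} (cert : PointBlowupCert B B' M)
  (hgen : ∀ w ∈ Bt', ∃ x ∈ Subring.closure ((Bt : Set L) ∪ B'), ∃ x' ∈ Subring.closure ((Bt : Set L) ∪ B'), x' ∈ unitSet Bt' ∧ w = x / x')

include hB' in
/-- Every element of the ring generated by `B̃ ∪ B'` is `N / D` with `N, D ∈ B̃[M/c_j]` and `D` a unit of `B̃'`. -/
theorem exists_frac_of_mem_closure {x : L} (hx : x ∈ Subring.closure ((Bt : Set L) ∪ B')) :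
    ∃ N ∈ chartClosure Bt (liftGen hB cert.c) cert.j, ∃ D ∈ chartClosure Bt (liftGen hB cert.c) cert.j, D ∈ unitSet Bt' ∧ x = N / D := by
  induction hx using Subring.closure_induction with
  | mem x hx =>
    rcases hx with hx | hx
    · exact ⟨x, le_chartClosure _ _ _ hx, 1, Subring.one_mem _, one_mem_unitSet, (div_one x).symm⟩
    · obtain ⟨y, hy, z, hz, hz0, hzinv, rfl⟩ := cert.frac x hx
      refine ⟨y, chartClosure_mono hB cert.c cert.j hy, z, chartClosure_mono hB cert.c cert.j hz, ?_, rfl⟩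
      exact mem_unitSet_iff.mpr ⟨hB' (cert.le hz), hB' hzinv, hz0⟩
  | zero => exact ⟨0, Subring.zero_mem _, 1, Subring.one_mem _, one_mem_unitSet, (div_one _).symm⟩
  | one => exact ⟨1, Subring.one_mem _, 1, Subring.one_mem _, one_mem_unitSet, (div_one _).symm⟩
  | add x y _ _ ihx ihy =>
    obtain ⟨N, hN, D, hD, hDu, rfl⟩ := ihx
    obtain ⟨N', hN', D', hD', hD'u, rfl⟩ := ihy
    refine ⟨N * D' + D * N', Subring.add_mem _ (Subring.mul_mem _ hN hD') (Subring.mul_mem _ hD hN'), D * D', Subring.mul_mem _ hD hD',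
      mul_mem_unitSet hDu hD'u, ?_⟩
    rw [div_add_div _ _ (mem_unitSet_iff.mp hDu).2.2 (mem_unitSet_iff.mp hD'u).2.2]
  | neg x _ ihx =>
    obtain ⟨N, hN, D, hD, hDu, rfl⟩ := ihx
    exact ⟨-N, Subring.neg_mem _ hN, D, hD, hDu, (neg_div _ _).symm⟩
  | mul x y _ _ ihx ihy =>
    obtain ⟨N, hN, D, hD, hDu, rfl⟩ := ihx
    obtain ⟨N', hN', D', hD', hD'u, rfl⟩ := ihy
    exact ⟨N * N', Subring.mul_mem _ hN hN', D * D', Subring.mul_mem _ hD hD', mul_mem_unitSet hDu hD'u, (div_mul_div_comm _ _ _ _)⟩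

/-- **The transported certificate** `PointBlowupCert B̃ B̃' (M B̃)`: same number of generators, same generators (moved to `B̃`), same chart index.
DEFINITION (support, data). [cite: NovacoskiSpivakovsky2014, Def. 2.11] -/
def transport : PointBlowupCert Bt Bt' (M.map (Subring.inclusion hB)) where
  r := cert.r
  c := liftGen hB cert.c
  j := cert.j
  span_eq := by
    have h := congrArg (Ideal.map (Subring.inclusion hB)) cert.span_eq
    rw [Ideal.map_span, ← Set.range_comp] at h
    exact h
  ne_zero := fun h => cert.ne_zero (Subtype.ext (by simpa using congrArg Subtype.val h))
  le := by
    refine Subring.closure_le.mpr ?_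
    rintro x (hx | ⟨y, ⟨l, rfl⟩, rfl⟩)
    · exact hBt hx
    · exact hB' (cert.le (ratio_mem_chartClosure B cert.c cert.j l))
  frac := by
    intro w hw
    obtain ⟨x, hx, x', hx', hx'u, rfl⟩ := hgen w hw
    obtain ⟨N, hN, D, hD, hDu, rfl⟩ := exists_frac_of_mem_closure hB hB' cert hx
    obtain ⟨N', hN', D', hD', hD'u, rfl⟩ := exists_frac_of_mem_closure hB hB' cert hx'
    have hN'u : N' ∈ unitSet Bt' := by
      have := mul_mem_unitSet hx'u hD'u
      rwa [div_mul_cancel₀ _ (mem_unitSet_iff.mp hD'u).2.2] at this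
    have hz := mul_mem_unitSet hDu hN'u
    refine ⟨N * D', Subring.mul_mem _ hN hD', D * N', Subring.mul_mem _ hD hN', (mem_unitSet_iff.mp hz).2.2, (mem_unitSet_iff.mp hz).2.1, ?_⟩
    rw [div_div_div_eq]

/-- The transported certificate has the same length `r` (definitional). -/
@[simp] theorem transport_r : (transport hB hBt hB' cert hgen).r = cert.r := rfl

/-- The transported certificate has the same exceptional index `j` (definitional). -/
@[simp] theorem transport_j : (transport hB hBt hB' cert hgen).j = cert.j := rfl

/-- The transported generators keep their values in `L` (definitional). -/
@[simp] theorem transport_coe_c (l : Fin cert.r) : ((transport hB hBt hB' cert hgen).c l : L) = cert.c l := rfl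

/-- The exceptional generator keeps its value in `L`. -/
theorem transport_coe_c_j : ((transport hB hBt hB' cert hgen).c (transport hB hBt hB' cert hgen).j : L) = cert.c cert.j := rfl

end Transport

/-! ## §3 Moving a certificate along an equality of base subrings -/

/-- **Cast.**  `frame_step` returns the equation `frameRing θ' = B̃'`; a certificate over `B̃'` along `M₂` is a certificate over any EQUAL subring `B₁` along the ideal
`M₁` with the same underlying set, with the same generator values. -/
theorem exists_cert_of_eq {B₁ B₂ B' : Subring L} (h : B₁ = B₂) {M₁ : Ideal B₁} {M₂ : Ideal B₂}
    (hM : ∀ x : L, (∃ hx : x ∈ B₁, (⟨x, hx⟩ : B₁) ∈ M₁) ↔ (∃ hx : x ∈ B₂, (⟨x, hx⟩ : B₂) ∈ M₂)) (cert : PointBlowupCert B₂ B' M₂) :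
    ∃ cert₁ : PointBlowupCert B₁ B' M₁, cert₁.r = cert.r ∧ ((cert₁.c cert₁.j : B₁) : L) = cert.c cert.j ∧
      ∀ l₁ : Fin cert₁.r, ∃ l : Fin cert.r, (cert₁.c l₁ : L) = cert.c l := by
  subst h
  have hM' : M₁ = M₂ := by
    ext ⟨x, hx⟩
    constructor
    · intro hm
      obtain ⟨hx', hm'⟩ := (hM x).mp ⟨hx, hm⟩
      exact hm'
    · intro hm
      obtain ⟨hx', hm'⟩ := (hM x).mpr ⟨hx, hm⟩
      exact hm'
  subst hM'
  exact ⟨cert, rfl, rfl, fun l => ⟨l, rfl⟩⟩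

end Summit.ResolutionOfSingularities.ResolutionOfSingularities.Theorems.KCert
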